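/-
Copyright: public domain mathematics; formalisation notes by the eng-sdp-4 engines lane (shared numerical
engines serving client cells; rigour lives in the verifiers).
-/
import Literature.MathematicalPhysics.QuantumFieldTheory.ConformalBootstrap3D.BlockPointEnclosureAB
import Literature.MathematicalPhysics.QuantumFieldTheory.ConformalBootstrap3D.HRCoeffABIntervalBounds
import HarnessLib

/-!
# A closed-form majorant for the reflection-positive diagonal series of a scalar exchange, `Δ₁₂ = −Δ₃₄` arbitrary

The point enclosure of a block with unequal external dimensions (`BlockPointEnclosureAB`,
`O2ExtBlockTables`) consumes ONE number per reflection-positive DIAGONAL series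
`D(c; y) = Σ_n a_n(c,c) y^{Δ+n}` (`diagSeriesAB c Δ 0 y`, `a_n(c,c) = Σ_j A_{n,j}(c,c)`, the level sums of
the Dolan–Osborn recursion coefficients `hrCoeffAB c c Δ 0`, DO 2004 §3 eqs. (3.11)–(3.12)): an upper bound
`U ≥ D(c; y')`. At `c = 0` such a number is the Leibniz enclosure of El-Showk et al.'s closed form
(`DiagonalScalarEqualExtClosedForm`); at `c ≠ 0` no closed form is known. This file supplies a closed-form
`U` for EVERY `c ≥ −1/2` and every exchanged SCALAR (`ℓ = 0`, `Δ > 1/2`) from the recursion itself: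

1. **Level transfer** (`hrLevelSumAB_self_succ_eq`): summing the recursion over the spins of level `n + 1`
   and re-indexing by the parent spin gives `a_{n+1} = Σ_i κ_{n,i} A_{n,i}` with
   `κ_{n,i} = γ⁺_{Δ+n,i}(c,c)/P_{n+1,i+1} + γ⁻_{Δ+n,i}(c,c)/P_{n+1,i−1}` (`diagKappa`; `P` = `casimirPivot3D`).
2. **Ratio bound** (`diagKappa_le_diagRatioBound`): for `n ≥ 2`, `0 ≤ i ≤ n`, `Δ ≥ 1/2`, `c ≥ −1/2`,
   `κ_{n,i} ≤ K_n := (Δ+n+2c)²/((n+1)(2Δ+n−2))` (`diagRatioBound`; `K_n → 1` like `1 + (1+4c)/n`). With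
   `F = Δ+n+2c`, `Q = (n+1)(2Δ+n−2)` one has `K_n − κ_{n,i} = Φ(F,Q,i)/(Q P⁺ P⁻)` for an explicit polynomial
   `Φ` (`diagPhiPoly`), `Φ(F,·,i)/·` is decreasing, `Q ≤ (n+1)(2F−n)`, and `Φ(F,(n+1)(2F−n),i)` is a polynomial
   with non-negative coefficients in `(F−n+1/2, i−1, n−1−i)` resp. `(F−n+1/2, n−2)` at `i = n` — a finite
   certificate checked by `ring` + `positivity`. Hence `a_{n+1}(c,c) ≤ K_n a_n(c,c)` (`hrDiagCoeffAB_self_succ_le`).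
3. **Geometric tail** (`diagTailAB_le_geom`, `diagSeriesAB_le_head_add_geom`): if `K_k ≤ q` for all
   `k ≥ N+1` (`DiagRatioDom`, implied by three rational inequalities `diagRatioDom_of_test`, and uniformly on a
   box `(Δ, c) ∈ [Δ₁,Δ₂] × [c₁,c₂]` by the test at the two corners `(Δ₁,c₂), (Δ₂,c₂)`, `diagRatioDom_on_box`)
   and `q y < 1`, then `𝒯_N(c; y) ≤ a_{N+1} y^{Δ+N+1}/(1 − q y)` and
   `D(c; y) ≤ S_N(c; y) + a_{N+1} y^{Δ+N+1}/(1 − q y)` — head, one more exact level, one geometric factor.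
4. **Uniformly on a parameter box** (`diagSeriesAB_le_boxBound`): with the interval tables
   `hrCoeffABHi c₁ c₂ Δ₁ Δ₂ 0` (`HRCoeffABIntervalBounds`) and `y^{Δ+n} ≤ y^{Δ₁+n}`, ONE closed-form number
   `diagBoxBound c₁ c₂ Δ₁ Δ₂ N q y ≥ D(c; y)` for every `(Δ, c)` of the box — the shape of the hypothesis
   `DiagBoundTable` of `O2ExtBlockTables.fTable_on_dbox` (one number per label, valid on the whole `D`-box).

NON-CLAIMS. Elementary real-algebra estimates on the Dolan–Osborn recursion (DO 2004 §3 eqs. (3.11)–(3.12))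
for scalar exchange only (`ℓ = 0`); the range `c ≥ −1/2`, `n ≥ 2` is where the single closed form `K_n`
dominates every transfer coefficient (at `n = 1` the `Δ → 1/2` pole of `P_{2,0}` is in the way, and for
`c < −1/2` the corner `i = n = 2` fails); more negative `c` is the conjugate parameter of `−c`
(`BlockConjugationSymmetry`). Nothing is evaluated, no table is instantiated, nothing is asserted about any
model. The file introduces the definitions `diagKappa`, `diagRatioBound`, `DiagRatioDom`, `DiagRatioTest`,
`diagLevelBoxBound`, `diagBoxBound` (and the private certificate polynomial `diagPhiPoly`) with their
soundness theorems; it is filed as kind `definition`.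
-/

noncomputable section

namespace Literature.MathematicalPhysics.QuantumFieldTheory.ConformalBootstrap3D

open Finset Set

/-! ### 1. Level transfer: `a_{n+1} = Σ_i κ_{n,i} A_{n,i}` -/

/-- The level-transfer coefficient of the scalar-exchange recursion,
`κ_{n,i}(c; Δ) = γ⁺_{Δ+n,i}(c,c)/P_{n+1,i+1} + γ⁻_{Δ+n,i}(c,c)/P_{n+1,i−1}` (`P` the Casimir pivot; at `i = 0`
the second weight vanishes). [cite: DolanOsborn2004, §3 eqs. (3.11)–(3.12)] -/
def diagKappa (c Δ : ℝ) (n i : ℕ) : ℝ :=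
  hrGammaPlusAB c c (Δ + n) i / casimirPivot3D Δ 0 (n + 1) (i + 1) +
    hrGammaMinusAB c c (Δ + n) i / casimirPivot3D Δ 0 (n + 1) (i - 1)

/-- **Level transfer.** Summing the recursion `A_{n+1,j} = (γ⁺_{j−1} A_{n,j−1} + γ⁻_{j+1} A_{n,j+1})/P_{n+1,j}`
over `j ≤ n + 1` and re-indexing by the parent spin: `a_{n+1}(c,c) = Σ_{i ≤ n} κ_{n,i} A_{n,i}(c,c)`
(scalar exchange). [cite: DolanOsborn2004, §3 eq. (3.12)] -/
theorem hrLevelSumAB_self_succ_eq (c Δ : ℝ) (n : ℕ) :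
    hrLevelSumAB c c Δ 0 (n + 1) = ∑ i ∈ range (n + 1), diagKappa c Δ n i * hrCoeffAB c c Δ 0 n i := by
  unfold hrLevelSumAB diagKappa
  have hstep : ∀ j, hrCoeffAB c c Δ 0 (n + 1) j =
      (if j = 0 then 0 else hrGammaPlusAB c c (Δ + n) (j - 1) * hrCoeffAB c c Δ 0 n (j - 1)) /
          casimirPivot3D Δ 0 (n + 1) j +
        hrGammaMinusAB c c (Δ + n) (j + 1) * hrCoeffAB c c Δ 0 n (j + 1) /
          casimirPivot3D Δ 0 (n + 1) j := fun j => by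
    rw [hrCoeffAB_succ, add_div]
  rw [zero_add, sum_congr rfl fun j _ => hstep j, sum_add_distrib]
  simp_rw [add_mul]
  rw [sum_add_distrib]
  congr 1
  · rw [sum_range_succ' _ (n + 1)]
    simp only [↓reduceIte, Nat.add_one_ne_zero, zero_div, add_zero, Nat.add_sub_cancel]
    exact sum_congr rfl fun i _ => by ring
  · rw [sum_range_succ, sum_range_succ]
    simp only [hrCoeffAB_eq_zero_of_lt c c Δ (show 0 + n < n + 1 by omega),
      hrCoeffAB_eq_zero_of_lt c c Δ (show 0 + n < n + 1 + 1 by omega), mul_zero, zero_div, add_zero]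
    rw [sum_range_succ' (fun i => hrGammaMinusAB c c (Δ + n) i / casimirPivot3D Δ 0 (n + 1) (i - 1) *
        hrCoeffAB c c Δ 0 n i) n]
    simp only [hrGammaMinusAB_zero, zero_div, zero_mul, add_zero, Nat.add_sub_cancel]
    exact sum_congr rfl fun i _ => by ring

/-! ### 2. The ratio bound `κ_{n,i} ≤ K_n` -/

/-- The closed-form level-ratio bound `K_n(c; Δ) = (Δ+n+2c)²/((n+1)(2Δ+n−2))`.
[cite: DolanOsborn2004, §3 eqs. (3.11)–(3.12)] -/
def diagRatioBound (c Δ : ℝ) (n : ℕ) : ℝ :=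
  (Δ + n + 2 * c) ^ 2 / (((n : ℝ) + 1) * (2 * Δ + n - 2))

/-- `K_n ≥ 0` from level two on (`Δ > 1/2`). [cite: DolanOsborn2004, §3 eq. (3.12)] -/
theorem diagRatioBound_nonneg {c Δ : ℝ} (hΔ : 1 / 2 < Δ) {n : ℕ} (hn : 2 ≤ n) : 0 ≤ diagRatioBound c Δ n := by
  unfold diagRatioBound
  have hn' : (2 : ℝ) ≤ n := by exact_mod_cast hn
  have : 0 < 2 * Δ + n - 2 := by linarith
  positivity

/-- The numerator polynomial `Φ(F, Q, x)` of `K_n − κ_{n,x}`: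
`Q·(F²(x²+x+2) + 4x(x+1)F − 2x(x+1)² − x²(x²−1) − x(x+1)Q) + F²(x−1)x(x+1)(x+2)`. [folklore] -/
private def diagPhiPoly (F Q x : ℝ) : ℝ :=
  Q * (F ^ 2 * (x ^ 2 + x + 2) + 4 * x * (x + 1) * F - 2 * x * (x + 1) ^ 2 - x ^ 2 * (x ^ 2 - 1) -
      x * (x + 1) * Q) + F ^ 2 * (x - 1) * x * (x + 1) * (x + 2)

/-- Certificate, interior spins: with `x = 1 + a`, `n = 2 + a + b`, `F = n − 1/2 + f` (`f, a, b ≥ 0`),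
`Φ(F, (n+1)(2F−n), x)` is a polynomial in `f, a, b` with non-negative coefficients. [folklore] -/
private theorem phiPoly_cert_lt {f a b : ℝ} (hf : 0 ≤ f) (ha : 0 ≤ a) (hb : 0 ≤ b) :
    0 ≤ diagPhiPoly (a + b + f + 3 / 2) ((a + b + 3) * (a + b + 2 * f + 1)) (a + 1) := by
  have key : diagPhiPoly (a + b + f + 3 / 2) ((a + b + 3) * (a + b + 2 * f + 1)) (a + 1) =
      (21 : ℝ) + (64 : ℝ) * b + (283/4 : ℝ) * a + (66 : ℝ) * f + (61 : ℝ) * b ^ 2 + (158 : ℝ) * a * b +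
      (185/2 : ℝ) * a ^ 2 + (130 : ℝ) * f * b + (287/2 : ℝ) * f * a + (60 : ℝ) * f ^ 2 + (20 : ℝ) * b ^ 3 +
      (399/4 : ℝ) * a * b ^ 2 + (285/2 : ℝ) * a ^ 2 * b + (233/4 : ℝ) * a ^ 3 + (60 : ℝ) * f * b ^ 2 +
      (387/2 : ℝ) * f * a * b + (111 : ℝ) * f * a ^ 2 + (56 : ℝ) * f ^ 2 * b + (89 : ℝ) * f ^ 2 * a +
      (24 : ℝ) * f ^ 3 + (2 : ℝ) * b ^ 4 + (17 : ℝ) * a * b ^ 3 + (209/4 : ℝ) * a ^ 2 * b ^ 2 +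
      (111/2 : ℝ) * a ^ 3 * b + (35/2 : ℝ) * a ^ 4 + (8 : ℝ) * f * b ^ 3 + (45 : ℝ) * f * a * b ^ 2 +
      (181/2 : ℝ) * f * a ^ 2 * b + (71/2 : ℝ) * f * a ^ 3 + (12 : ℝ) * f ^ 2 * b ^ 2 +
      (42 : ℝ) * f ^ 2 * a * b + (50 : ℝ) * f ^ 2 * a ^ 2 + (8 : ℝ) * f ^ 3 * b + (26 : ℝ) * f ^ 3 * a +
      (3 : ℝ) * a ^ 2 * b ^ 3 + (9 : ℝ) * a ^ 3 * b ^ 2 + (8 : ℝ) * a ^ 4 * b + (2 : ℝ) * a ^ 5 +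
      (7 : ℝ) * f * a ^ 2 * b ^ 2 + (14 : ℝ) * f * a ^ 3 * b + (4 : ℝ) * f * a ^ 4 +
      (3 : ℝ) * f ^ 2 * a * b ^ 2 + (12 : ℝ) * f ^ 2 * a ^ 2 * b + (15 : ℝ) * f ^ 2 * a ^ 3 +
      (6 : ℝ) * f ^ 3 * a * b + (12 : ℝ) * f ^ 3 * a ^ 2 + (1 : ℝ) * f ^ 2 * a ^ 2 * b ^ 2 +
      (2 : ℝ) * f ^ 2 * a ^ 3 * b + (2 : ℝ) * f ^ 2 * a ^ 4 + (2 : ℝ) * f ^ 3 * a ^ 2 * b +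
      (2 : ℝ) * f ^ 3 * a ^ 3 := by
    unfold diagPhiPoly; ring
  rw [key]; positivity

/-- Certificate, top spin `x = n = 2 + a`, `F = n − 1/2 + f` (`f, a ≥ 0`): `Φ(F, (n+1)(2F−n), n)` is a
polynomial in `f, a` with non-negative coefficients. [folklore] -/
private theorem phiPoly_cert_eq {f a : ℝ} (hf : 0 ≤ f) (ha : 0 ≤ a) :
    0 ≤ diagPhiPoly (a + f + 3 / 2) ((a + 3) * (a + 2 * f + 1)) (a + 2) := by
  have key : diagPhiPoly (a + f + 3 / 2) ((a + 3) * (a + 2 * f + 1)) (a + 2) =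
      (18 : ℝ) + (309/4 : ℝ) * a + (36 : ℝ) * f + (223/2 : ℝ) * a ^ 2 + (261/2 : ℝ) * f * a +
      (120 : ℝ) * f ^ 2 + (279/4 : ℝ) * a ^ 3 + (116 : ℝ) * f * a ^ 2 + (175 : ℝ) * f ^ 2 * a +
      (48 : ℝ) * f ^ 3 + (39/2 : ℝ) * a ^ 4 + (75/2 : ℝ) * f * a ^ 3 + (90 : ℝ) * f ^ 2 * a ^ 2 +
      (46 : ℝ) * f ^ 3 * a + (2 : ℝ) * a ^ 5 + (4 : ℝ) * f * a ^ 4 + (21 : ℝ) * f ^ 2 * a ^ 3 +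
      (16 : ℝ) * f ^ 3 * a ^ 2 + (2 : ℝ) * f ^ 2 * a ^ 4 + (2 : ℝ) * f ^ 3 * a ^ 3 := by
    unfold diagPhiPoly; ring
  rw [key]; positivity

/-- `Φ(F, (n+1)(2F−n), x) ≥ 0` for `1 ≤ x ≤ n`, `n ≥ 2`, `F ≥ n − 1/2` (`x, n` real images of naturals:
`x + 1 ≤ n` or `x = n`). [folklore] -/
private theorem phiPoly_top_nonneg {F m x : ℝ} (hx1 : 1 ≤ x) (hm : 2 ≤ m) (hint : x + 1 ≤ m ∨ x = m)
    (hF : m - 1 / 2 ≤ F) : 0 ≤ diagPhiPoly F ((m + 1) * (2 * F - m)) x := by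
  rcases hint with h | h
  · have hf : 0 ≤ F - m + 1 / 2 := by linarith
    have ha : 0 ≤ x - 1 := by linarith
    have hb : 0 ≤ m - 1 - x := by linarith
    have key := phiPoly_cert_lt hf ha hb
    convert key using 2 <;> ring
  · subst h
    have hf : 0 ≤ F - x + 1 / 2 := by linarith
    have ha : 0 ≤ x - 2 := by linarith
    have key := phiPoly_cert_eq hf ha
    convert key using 2 <;> ring

/-- The cleared-denominator form of `κ_{n,x} ≤ F²/Q`: for `0 < Q ≤ (n+1)(2F−n)` (i.e. `c ≥ −1/2`) and
`F ≥ n − 1/2` (i.e. `Δ ≥ 1/2`), `((F² + x(x+1))(Q + x(x−1)) + 2x(F−x−1)²)·Q ≤ F²·(Q + (x+1)(x+2))(Q + x(x−1))`.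
[folklore] -/
private theorem diagKappa_core {F Q m x : ℝ} (hx1 : 1 ≤ x) (hm : 2 ≤ m) (hint : x + 1 ≤ m ∨ x = m)
    (hQ0 : 0 < Q) (hQ : Q ≤ (m + 1) * (2 * F - m)) (hF : m - 1 / 2 ≤ F) :
    ((F ^ 2 + x * (x + 1)) * (Q + x * (x - 1)) + 2 * x * (F - x - 1) ^ 2) * Q ≤
      F ^ 2 * ((Q + (x + 1) * (x + 2)) * (Q + x * (x - 1))) := by
  have hΨ := phiPoly_top_nonneg hx1 hm hint hF
  have hQm : 0 < (m + 1) * (2 * F - m) := lt_of_lt_of_le hQ0 hQ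
  have hx0 : 0 ≤ x - 1 := by linarith
  have hγ : 0 ≤ x * (x + 1) * Q * ((m + 1) * (2 * F - m)) + F ^ 2 * (x - 1) * x * (x + 1) * (x + 2) := by
    positivity
  have hmono : (m + 1) * (2 * F - m) * diagPhiPoly F Q x =
      Q * diagPhiPoly F ((m + 1) * (2 * F - m)) x +
        ((m + 1) * (2 * F - m) - Q) *
          (x * (x + 1) * Q * ((m + 1) * (2 * F - m)) + F ^ 2 * (x - 1) * x * (x + 1) * (x + 2)) := by
    unfold diagPhiPoly; ring
  have hΦ' : 0 ≤ (m + 1) * (2 * F - m) * diagPhiPoly F Q x := by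
    rw [hmono]
    have : 0 ≤ (m + 1) * (2 * F - m) - Q := sub_nonneg.2 hQ
    positivity
  have hΦ : 0 ≤ diagPhiPoly F Q x := le_of_mul_le_mul_left (by rwa [mul_zero]) hQm
  have hid : F ^ 2 * ((Q + (x + 1) * (x + 2)) * (Q + x * (x - 1))) -
      ((F ^ 2 + x * (x + 1)) * (Q + x * (x - 1)) + 2 * x * (F - x - 1) ^ 2) * Q = diagPhiPoly F Q x := by
    unfold diagPhiPoly; ring
  linarith [hΦ, hid]

/-- **Ratio bound.** For a scalar exchange with `Δ ≥ 1/2`, `c ≥ −1/2`, every transfer coefficient from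
level `n ≥ 2` is below the closed form: `κ_{n,i}(c; Δ) ≤ K_n(c; Δ)`, `0 ≤ i ≤ n`.
[cite: DolanOsborn2004, §3 eqs. (3.11)–(3.12)] -/
theorem diagKappa_le_diagRatioBound {c Δ : ℝ} (hΔ : 1 / 2 ≤ Δ) (hc : -1 / 2 ≤ c) {n i : ℕ} (hn : 2 ≤ n)
    (hi : i ≤ n) : diagKappa c Δ n i ≤ diagRatioBound c Δ n := by
  have hn' : (2 : ℝ) ≤ n := by exact_mod_cast hn
  have hi' : (i : ℝ) ≤ n := by exact_mod_cast hi
  unfold diagKappa diagRatioBound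
  set F : ℝ := Δ + n + 2 * c with hF
  set Q : ℝ := ((n : ℝ) + 1) * (2 * Δ + n - 2) with hQ
  have hQpos : 0 < 2 * Δ + n - 2 := by linarith
  have hQ0 : 0 < Q := by positivity
  have hQle : Q ≤ ((n : ℝ) + 1) * (2 * F - n) :=
    mul_le_mul_of_nonneg_left (by rw [hF]; linarith) (by positivity)
  have hFge : (n : ℝ) - 1 / 2 ≤ F := by rw [hF]; linarith
  have hP1 : casimirPivot3D Δ 0 (n + 1) (i + 1) = Q + ((i : ℝ) + 1) * ((i : ℝ) + 2) := by
    unfold casimirPivot3D; push_cast; rw [hQ]; ring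
  have hPp : 0 < Q + ((i : ℝ) + 1) * ((i : ℝ) + 2) := by positivity
  rcases Nat.eq_zero_or_pos i with rfl | hi1
  · simp only [hrGammaMinusAB_zero, zero_div, add_zero]
    rw [hP1]
    have hγ : hrGammaPlusAB c c (Δ + n) 0 = F ^ 2 := by
      unfold hrGammaPlusAB; push_cast; rw [hF]; ring
    rw [hγ]
    push_cast
    exact div_le_div_of_nonneg_left (sq_nonneg F) hQ0 (by nlinarith)
  · have hx1 : (1 : ℝ) ≤ i := by exact_mod_cast hi1
    have hP2 : casimirPivot3D Δ 0 (n + 1) (i - 1) = Q + (i : ℝ) * ((i : ℝ) - 1) := by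
      unfold casimirPivot3D; rw [Nat.cast_sub hi1]; push_cast; rw [hQ]; ring
    have hii : 0 ≤ (i : ℝ) * ((i : ℝ) - 1) := mul_nonneg (by positivity) (by linarith)
    have hPm : 0 < Q + (i : ℝ) * ((i : ℝ) - 1) := by linarith
    have hγp : hrGammaPlusAB c c (Δ + n) i = (F + i) ^ 2 * ((i : ℝ) + 1) / (2 * i + 1) := by
      unfold hrGammaPlusAB; rw [hF]; ring
    have hγm : hrGammaMinusAB c c (Δ + n) i = (F - i - 1) ^ 2 * (i : ℝ) / (2 * i + 1) := by
      unfold hrGammaMinusAB; rw [hF]; ring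
    rw [hP1, hP2, hγp, hγm, div_add_div _ _ hPp.ne' hPm.ne', div_le_div_iff₀ (mul_pos hPp hPm) hQ0]
    have h2i : (2 : ℝ) * i + 1 ≠ 0 := by positivity
    have hsum : (F + i) ^ 2 * ((i : ℝ) + 1) / (2 * i + 1) * (Q + (i : ℝ) * ((i : ℝ) - 1)) +
        (Q + ((i : ℝ) + 1) * ((i : ℝ) + 2)) * ((F - i - 1) ^ 2 * (i : ℝ) / (2 * i + 1)) =
        (F ^ 2 + i * (i + 1)) * (Q + i * (i - 1)) + 2 * i * (F - i - 1) ^ 2 := by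
      field_simp; ring
    rw [hsum]
    have hint : (i : ℝ) + 1 ≤ n ∨ (i : ℝ) = n := by
      rcases Nat.lt_or_ge i n with h | h
      · left; exact_mod_cast Nat.succ_le_of_lt h
      · right; exact_mod_cast le_antisymm hi h
    exact diagKappa_core hx1 hn' hint hQ0 hQle hFge

/-- **Level-sum ratio bound**: `a_{n+1}(c,c) ≤ K_n(c; Δ)·a_n(c,c)` for a scalar exchange above the bound,
`c ≥ −1/2`, `n ≥ 2`. [cite: DolanOsborn2004, §3 eqs. (3.11)–(3.12)] -/
theorem hrLevelSumAB_self_succ_le {c Δ : ℝ} (hΔ : unitarityBound3D 0 < Δ) (hc : -1 / 2 ≤ c) {n : ℕ}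
    (hn : 2 ≤ n) : hrLevelSumAB c c Δ 0 (n + 1) ≤ diagRatioBound c Δ n * hrLevelSumAB c c Δ 0 n := by
  have hhalf : 1 / 2 < Δ := one_half_lt_of_unitarityBound3D_lt hΔ
  rw [hrLevelSumAB_self_succ_eq c Δ n]
  unfold hrLevelSumAB
  rw [zero_add, mul_sum]
  refine sum_le_sum fun i hi => ?_
  have hin : i ≤ n := by have := mem_range.1 hi; omega
  exact mul_le_mul_of_nonneg_right (diagKappa_le_diagRatioBound hhalf.le hc hn hin)
    (hrCoeffAB_self_nonneg c hΔ n i)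

/-- The same for the diagonal coefficients `a_n(c,c)/λ₀` (`λ₀ = 1`): `a_{n+1} ≤ K_n a_n`.
[cite: DolanOsborn2004, §3 eqs. (3.11)–(3.12)] -/
theorem hrDiagCoeffAB_self_succ_le {c Δ : ℝ} (hΔ : unitarityBound3D 0 < Δ) (hc : -1 / 2 ≤ c) {n : ℕ}
    (hn : 2 ≤ n) : hrDiagCoeffAB c c Δ 0 (n + 1) ≤ diagRatioBound c Δ n * hrDiagCoeffAB c c Δ 0 n := by
  unfold hrDiagCoeffAB
  rw [legendreLam_zero, div_one, div_one]
  exact hrLevelSumAB_self_succ_le hΔ hc hn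

/-! ### 3. Ratio domination from a level on, and its finite test -/

/-- `q` dominates every level ratio bound from level `N` on: `K_k(c; Δ) ≤ q` for all `k ≥ N`.
[cite: DolanOsborn2004, §3 eq. (3.12)] -/
def DiagRatioDom (c Δ : ℝ) (N : ℕ) (q : ℝ) : Prop :=
  ∀ k : ℕ, N ≤ k → diagRatioBound c Δ k ≤ q

/-- The finite test at level `N`: value and slope of `q(k+1)(2Δ+k−2) − (Δ+k+2c)²` at `k = N` are `≥ 0`
(three closed-form numbers built from the recursion's weights and pivots).
[cite: DolanOsborn2004, §3 eqs. (3.11)–(3.12)] -/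
def DiagRatioTest (c Δ : ℝ) (N : ℕ) (q : ℝ) : Prop :=
  (Δ + N + 2 * c) ^ 2 ≤ q * (((N : ℝ) + 1) * (2 * Δ + N - 2)) ∧
    2 * (Δ + N + 2 * c) ≤ q * (2 * Δ + 2 * N - 1)

/-- **Geometric growth from level `N`.** Under domination, `a_{N+m}(c,c) ≤ q^m a_N(c,c)` (`N ≥ 2`).
[cite: DolanOsborn2004, §3 eqs. (3.11)–(3.12)] -/
theorem hrDiagCoeffAB_self_add_le_pow {c Δ : ℝ} (hΔ : unitarityBound3D 0 < Δ) (hc : -1 / 2 ≤ c) {N : ℕ}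
    (hN : 2 ≤ N) {q : ℝ} (hq : DiagRatioDom c Δ N q) (m : ℕ) :
    hrDiagCoeffAB c c Δ 0 (N + m) ≤ q ^ m * hrDiagCoeffAB c c Δ 0 N := by
  have hhalf : 1 / 2 < Δ := one_half_lt_of_unitarityBound3D_lt hΔ
  induction m with
  | zero => simp
  | succ m ih =>
    have hK := hq (N + m) (by omega)
    have hq0 : 0 ≤ q := le_trans (diagRatioBound_nonneg hhalf (by omega)) hK
    have ha : 0 ≤ hrDiagCoeffAB c c Δ 0 (N + m) := hrDiagCoeffAB_self_nonneg c hΔ _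
    calc hrDiagCoeffAB c c Δ 0 (N + m + 1)
        ≤ diagRatioBound c Δ (N + m) * hrDiagCoeffAB c c Δ 0 (N + m) :=
          hrDiagCoeffAB_self_succ_le hΔ hc (by omega)
      _ ≤ q * (q ^ m * hrDiagCoeffAB c c Δ 0 N) := mul_le_mul hK ih ha hq0
      _ = q ^ (m + 1) * hrDiagCoeffAB c c Δ 0 N := by ring

/-- **The finite test implies domination**: a quadratic in `k` with leading coefficient `q − 1 ≥ 0`,
non-negative value and slope at `k = N`, is non-negative for `k ≥ N` (exact Taylor expansion).
[cite: DolanOsborn2004, §3 eqs. (3.11)–(3.12)] -/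
theorem diagRatioDom_of_test {c Δ q : ℝ} {N : ℕ} (hΔ : 1 / 2 < Δ) (hN : 2 ≤ N) (h1 : 1 ≤ q)
    (ht : DiagRatioTest c Δ N q) : DiagRatioDom c Δ N q := by
  intro k hk
  obtain ⟨h2, h3⟩ := ht
  unfold diagRatioBound
  have hk' : (N : ℝ) ≤ k := by exact_mod_cast hk
  have hN' : (2 : ℝ) ≤ N := by exact_mod_cast hN
  have hpos : 0 < 2 * Δ + k - 2 := by linarith
  have hden : 0 < ((k : ℝ) + 1) * (2 * Δ + k - 2) := by positivity
  rw [div_le_iff₀ hden]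
  have key : q * (((k : ℝ) + 1) * (2 * Δ + k - 2)) - (Δ + k + 2 * c) ^ 2 =
      (q * (((N : ℝ) + 1) * (2 * Δ + N - 2)) - (Δ + N + 2 * c) ^ 2) +
        (q * (2 * Δ + 2 * N - 1) - 2 * (Δ + N + 2 * c)) * ((k : ℝ) - N) +
          (q - 1) * ((k : ℝ) - N) ^ 2 := by
    ring
  have t2 : 0 ≤ (q * (2 * Δ + 2 * N - 1) - 2 * (Δ + N + 2 * c)) * ((k : ℝ) - N) :=
    mul_nonneg (by linarith) (by linarith)
  have t3 : 0 ≤ (q - 1) * ((k : ℝ) - N) ^ 2 := mul_nonneg (by linarith) (sq_nonneg _)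
  linarith [key, t2, t3]

/-- **Domination uniformly on a parameter box.** `q(k+1)(2Δ+k−2) − (Δ+k+2c)²` is decreasing in `c` and
concave in `Δ`; so the test at the two corners `(Δ₁, c₂)`, `(Δ₂, c₂)` (with `q ≥ 1`) gives `K_k(c; Δ) ≤ q`
for all `k ≥ N` and every `(Δ, c) ∈ [Δ₁, Δ₂] × [c₁, c₂]` (`Δ₁ > 1/2`, `c₁ ≥ −1/2`) — an interval
evaluation over the parameter box by monotonicity/concavity.
[cite: DolanOsborn2004, §3 eqs. (3.11)–(3.12)] [cite: Moore1979, §2.2 eq. (2.19), §2.4] -/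
theorem diagRatioDom_on_box {c₁ c₂ Δ₁ Δ₂ q : ℝ} {N : ℕ} (hΔ₁ : 1 / 2 < Δ₁) (h12 : Δ₁ ≤ Δ₂)
    (hc₁ : -1 / 2 ≤ c₁) (hN : 2 ≤ N) (h1 : 1 ≤ q) (htA : DiagRatioTest c₂ Δ₁ N q)
    (htB : DiagRatioTest c₂ Δ₂ N q) {Δ c : ℝ} (hΔl : Δ₁ ≤ Δ) (hΔu : Δ ≤ Δ₂) (hcl : c₁ ≤ c)
    (hcu : c ≤ c₂) : DiagRatioDom c Δ N q := by
  intro k hk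
  have dA := diagRatioDom_of_test hΔ₁ hN h1 htA k hk
  have dB := diagRatioDom_of_test (lt_of_lt_of_le hΔ₁ h12) hN h1 htB k hk
  unfold diagRatioBound at dA dB ⊢
  have hk' : (N : ℝ) ≤ k := by exact_mod_cast hk
  have hN' : (2 : ℝ) ≤ N := by exact_mod_cast hN
  have hposA : 0 < 2 * Δ₁ + k - 2 := by linarith
  have hposB : 0 < 2 * Δ₂ + k - 2 := by linarith
  have hpos : 0 < 2 * Δ + k - 2 := by linarith
  have hdenA : 0 < ((k : ℝ) + 1) * (2 * Δ₁ + k - 2) := by positivity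
  have hdenB : 0 < ((k : ℝ) + 1) * (2 * Δ₂ + k - 2) := by positivity
  have hden : 0 < ((k : ℝ) + 1) * (2 * Δ + k - 2) := by positivity
  rw [div_le_iff₀ hdenA] at dA
  rw [div_le_iff₀ hdenB] at dB
  rw [div_le_iff₀ hden]
  -- monotonicity in `c`
  have hF0 : 0 ≤ Δ + k + 2 * c := by linarith
  have hsq : (Δ + k + 2 * c) ^ 2 ≤ (Δ + k + 2 * c₂) ^ 2 := by
    apply sq_le_sq'
    · linarith
    · linarith
  -- concavity in `Δ` (leading coefficient `−1`): exact interpolation identity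
  have key : (Δ₂ - Δ₁) * (q * (((k : ℝ) + 1) * (2 * Δ + k - 2)) - (Δ + k + 2 * c₂) ^ 2) =
      (Δ₂ - Δ) * (q * (((k : ℝ) + 1) * (2 * Δ₁ + k - 2)) - (Δ₁ + k + 2 * c₂) ^ 2) +
        (Δ - Δ₁) * (q * (((k : ℝ) + 1) * (2 * Δ₂ + k - 2)) - (Δ₂ + k + 2 * c₂) ^ 2) +
          (Δ₂ - Δ₁) * ((Δ - Δ₁) * (Δ₂ - Δ)) := by
    ring
  rcases eq_or_lt_of_le h12 with heq | hlt
  · have hΔe : Δ = Δ₁ := le_antisymm (hΔu.trans heq.ge) hΔl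
    subst hΔe
    linarith
  · have t1 : 0 ≤ (Δ₂ - Δ) * (q * (((k : ℝ) + 1) * (2 * Δ₁ + k - 2)) - (Δ₁ + k + 2 * c₂) ^ 2) :=
      mul_nonneg (by linarith) (by linarith)
    have t2 : 0 ≤ (Δ - Δ₁) * (q * (((k : ℝ) + 1) * (2 * Δ₂ + k - 2)) - (Δ₂ + k + 2 * c₂) ^ 2) :=
      mul_nonneg (by linarith) (by linarith)
    have t3 : 0 ≤ (Δ₂ - Δ₁) * ((Δ - Δ₁) * (Δ₂ - Δ)) :=
      mul_nonneg (by linarith) (mul_nonneg (by linarith) (by linarith))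
    have hprod : 0 ≤ (Δ₂ - Δ₁) * (q * (((k : ℝ) + 1) * (2 * Δ + k - 2)) - (Δ + k + 2 * c₂) ^ 2) := by
      rw [key]; linarith
    have hmain : 0 ≤ q * (((k : ℝ) + 1) * (2 * Δ + k - 2)) - (Δ + k + 2 * c₂) ^ 2 :=
      le_of_mul_le_mul_left (by rwa [mul_zero]) (sub_pos.2 hlt)
    linarith

/-! ### 4. The geometric tail and the closed-form majorant of `D(c; y)` -/

/-- **Geometric tail bound.** For a scalar exchange above the bound, `c ≥ −1/2`, `N ≥ 1`, `0 < y < 1` and a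
ratio dominator `q` from level `N + 1` with `q y < 1`:
`𝒯_N(c; y) ≤ a_{N+1}(c,c) y^{Δ+N+1}/(1 − q y)` (termwise `a_{N+1+m} y^{Δ+N+1+m} ≤ a_{N+1} y^{Δ+N+1} (q y)^m`).
[cite: DolanOsborn2004, §3 eqs. (3.11)–(3.12)] -/
theorem diagTailAB_le_geom {c Δ : ℝ} (hΔ : unitarityBound3D 0 < Δ) (hc : -1 / 2 ≤ c) {N : ℕ} (hN : 1 ≤ N)
    {q y : ℝ} (hy0 : 0 < y) (hy1 : y < 1) (hqy : q * y < 1) (hdom : DiagRatioDom c Δ (N + 1) q) :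
    diagTailAB c Δ 0 N y ≤ hrDiagCoeffAB c c Δ 0 (N + 1) * y ^ (Δ + N + 1) / (1 - q * y) := by
  have hhalf : 1 / 2 < Δ := one_half_lt_of_unitarityBound3D_lt hΔ
  have hq0 : 0 ≤ q := le_trans (diagRatioBound_nonneg hhalf (by omega : 2 ≤ N + 1)) (hdom (N + 1) le_rfl)
  have hqy0 : 0 ≤ q * y := mul_nonneg hq0 hy0.le
  have hY : 0 ≤ y ^ (Δ + N + 1) := Real.rpow_nonneg hy0.le _
  have hterm : ∀ m : ℕ, hrDiagCoeffAB c c Δ 0 (m + (N + 1)) * y ^ ((Δ + N + 1) + (m : ℝ)) ≤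
      hrDiagCoeffAB c c Δ 0 (N + 1) * y ^ (Δ + N + 1) * (q * y) ^ m := by
    intro m
    rw [Real.rpow_add hy0, Real.rpow_natCast, mul_pow, add_comm m (N + 1)]
    have h1 := hrDiagCoeffAB_self_add_le_pow hΔ hc (by omega : 2 ≤ N + 1) hdom m
    have hw : 0 ≤ y ^ (Δ + N + 1) * y ^ m := by positivity
    calc hrDiagCoeffAB c c Δ 0 (N + 1 + m) * (y ^ (Δ + N + 1) * y ^ m)
        ≤ q ^ m * hrDiagCoeffAB c c Δ 0 (N + 1) * (y ^ (Δ + N + 1) * y ^ m) :=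
          mul_le_mul_of_nonneg_right h1 hw
      _ = hrDiagCoeffAB c c Δ 0 (N + 1) * y ^ (Δ + N + 1) * (q ^ m * y ^ m) := by ring
  have hsL := summable_diagTailAB c hΔ ⟨hy0, hy1⟩ N
  have hsR : Summable fun m : ℕ => hrDiagCoeffAB c c Δ 0 (N + 1) * y ^ (Δ + N + 1) * (q * y) ^ m :=
    (summable_geometric_of_lt_one hqy0 hqy).mul_left _
  calc diagTailAB c Δ 0 N y
      = ∑' m : ℕ, hrDiagCoeffAB c c Δ 0 (m + (N + 1)) * y ^ ((Δ + N + 1) + (m : ℝ)) := rfl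
    _ ≤ ∑' m : ℕ, hrDiagCoeffAB c c Δ 0 (N + 1) * y ^ (Δ + N + 1) * (q * y) ^ m :=
        Summable.tsum_le_tsum hterm hsL hsR
    _ = hrDiagCoeffAB c c Δ 0 (N + 1) * y ^ (Δ + N + 1) * ∑' m : ℕ, (q * y) ^ m := tsum_mul_left
    _ = hrDiagCoeffAB c c Δ 0 (N + 1) * y ^ (Δ + N + 1) / (1 - q * y) := by
        rw [tsum_geometric_of_lt_one hqy0 hqy, div_eq_mul_inv]

/-- **Closed-form majorant of the diagonal series.** Under the same hypotheses,
`D(c; y) ≤ S_N(c; y) + a_{N+1}(c,c) y^{Δ+N+1}/(1 − q y)` — a head of exact recursion values, one more exact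
level, one geometric factor: the number `U` of `BlockPointEnclosureAB.diagTailAB_le_of_diagSeriesAB_le` /
`O2ExtBlockTables.DiagBoundTable` at any `c ≥ −1/2`. [cite: DolanOsborn2004, §3 eqs. (3.11)–(3.12)] -/
theorem diagSeriesAB_le_head_add_geom {c Δ : ℝ} (hΔ : unitarityBound3D 0 < Δ) (hc : -1 / 2 ≤ c) {N : ℕ}
    (hN : 1 ≤ N) {q y : ℝ} (hy0 : 0 < y) (hy1 : y < 1) (hqy : q * y < 1)
    (hdom : DiagRatioDom c Δ (N + 1) q) :
    diagSeriesAB c Δ 0 y ≤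
      hrDiagPartialSumAB c c Δ 0 N y + hrDiagCoeffAB c c Δ 0 (N + 1) * y ^ (Δ + N + 1) / (1 - q * y) := by
  rw [diagSeriesAB_eq_partialSum_add_tail c hΔ ⟨hy0, hy1⟩ N]
  exact add_le_add le_rfl (diagTailAB_le_geom hΔ hc hN hy0 hy1 hqy hdom)

/-- The same with the finite test in place of domination (`N + 1 ≥ 2`, `q ≥ 1`).
[cite: DolanOsborn2004, §3 eqs. (3.11)–(3.12)] -/
theorem diagSeriesAB_le_head_add_geom_of_test {c Δ : ℝ} (hΔ : unitarityBound3D 0 < Δ) (hc : -1 / 2 ≤ c)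
    {N : ℕ} (hN : 1 ≤ N) {q y : ℝ} (hy0 : 0 < y) (hy1 : y < 1) (h1 : 1 ≤ q) (hqy : q * y < 1)
    (ht : DiagRatioTest c Δ (N + 1) q) :
    diagSeriesAB c Δ 0 y ≤
      hrDiagPartialSumAB c c Δ 0 N y + hrDiagCoeffAB c c Δ 0 (N + 1) * y ^ (Δ + N + 1) / (1 - q * y) :=
  diagSeriesAB_le_head_add_geom hΔ hc hN hy0 hy1 hqy
    (diagRatioDom_of_test (one_half_lt_of_unitarityBound3D_lt hΔ) (by omega) h1 ht)

/-! ### 5. One number per parameter box -/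

/-- Upper bound of the level sum `a_n(c,c; Δ)` on the box `[Δ₁,Δ₂] × [c₁,c₂]` from the interval table:
`Σ_{j ≤ n} Hi_{n,j}`. [cite: DolanOsborn2004, §3 eqs. (3.11)–(3.12)] -/
def diagLevelBoxBound (c₁ c₂ Δ₁ Δ₂ : ℝ) (n : ℕ) : ℝ :=
  ∑ j ∈ range (n + 1), hrCoeffABHi c₁ c₂ Δ₁ Δ₂ 0 n j

/-- The closed-form box majorant
`Σ_{n ≤ N} (Σ_j Hi_{n,j}) y^{Δ₁+n} + (Σ_j Hi_{N+1,j}) y^{Δ₁+N+1}/(1 − q y)`. [cite: DolanOsborn2004, §3 eqs. (3.11)–(3.12)] -/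
def diagBoxBound (c₁ c₂ Δ₁ Δ₂ : ℝ) (N : ℕ) (q y : ℝ) : ℝ :=
  ∑ n ∈ range (N + 1), diagLevelBoxBound c₁ c₂ Δ₁ Δ₂ n * y ^ (Δ₁ + n) +
    diagLevelBoxBound c₁ c₂ Δ₁ Δ₂ (N + 1) * y ^ (Δ₁ + N + 1) / (1 - q * y)

/-- `a_n(c,c; Δ) ≤ Σ_j Hi_{n,j}` on the box (scalar exchange, `Δ₁` above the bound).
[cite: DolanOsborn2004, §3 eqs. (3.11)–(3.12)] -/
theorem hrDiagCoeffAB_self_le_levelBoxBound {c₁ c c₂ Δ₁ Δ Δ₂ : ℝ} (hΔ₁ : unitarityBound3D 0 < Δ₁)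
    (hΔl : Δ₁ ≤ Δ) (hΔu : Δ ≤ Δ₂) (hcl : c₁ ≤ c) (hcu : c ≤ c₂) (n : ℕ) :
    hrDiagCoeffAB c c Δ 0 n ≤ diagLevelBoxBound c₁ c₂ Δ₁ Δ₂ n := by
  unfold hrDiagCoeffAB diagLevelBoxBound hrLevelSumAB
  rw [legendreLam_zero, div_one, zero_add]
  exact sum_le_sum fun j _ => (hrCoeffAB_self_mem_Icc_interval hΔ₁ hΔl hΔu hcl hcu n j).2.2

/-- **One closed-form number per box.** For every `(Δ, c) ∈ [Δ₁, Δ₂] × [c₁, c₂]` (`Δ₁ > 1/2` the scalar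
bound, `c₁ ≥ −1/2`), `0 < y < 1`, `q ≥ 1` with `q y < 1` passing the test at the corners `(Δ₁, c₂)` and
`(Δ₂, c₂)` at level `N + 1` (`N ≥ 1`): `D(c; y) ≤ diagBoxBound c₁ c₂ Δ₁ Δ₂ N q y` — the hypothesis
`DiagBoundTable` of `O2ExtBlockTables.fTable_on_dbox` with ONE number per label on the whole box.
[cite: DolanOsborn2004, §3 eqs. (3.11)–(3.12)] [cite: Moore1979, §2.2 eq. (2.19), §2.4] -/
theorem diagSeriesAB_le_boxBound {c₁ c c₂ Δ₁ Δ Δ₂ q y : ℝ} {N : ℕ} (hΔ₁ : unitarityBound3D 0 < Δ₁)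
    (hΔl : Δ₁ ≤ Δ) (hΔu : Δ ≤ Δ₂) (hc₁ : -1 / 2 ≤ c₁) (hcl : c₁ ≤ c) (hcu : c ≤ c₂) (hN : 1 ≤ N)
    (hy0 : 0 < y) (hy1 : y < 1) (h1 : 1 ≤ q) (hqy : q * y < 1) (htA : DiagRatioTest c₂ Δ₁ (N + 1) q)
    (htB : DiagRatioTest c₂ Δ₂ (N + 1) q) :
    diagSeriesAB c Δ 0 y ≤ diagBoxBound c₁ c₂ Δ₁ Δ₂ N q y := by
  have hhalf₁ : 1 / 2 < Δ₁ := one_half_lt_of_unitarityBound3D_lt hΔ₁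
  have hΔ : unitarityBound3D 0 < Δ := lt_of_lt_of_le hΔ₁ hΔl
  have hc : -1 / 2 ≤ c := le_trans hc₁ hcl
  have hdom : DiagRatioDom c Δ (N + 1) q :=
    diagRatioDom_on_box hhalf₁ (hΔl.trans hΔu) hc₁ (by omega) h1 htA htB hΔl hΔu hcl hcu
  have hmain := diagSeriesAB_le_head_add_geom hΔ hc hN hy0 hy1 hqy hdom
  have hq0 : 0 ≤ q * y := mul_nonneg (by linarith) hy0.le
  have hgeo : 0 < 1 - q * y := by linarith
  -- termwise: `a_n(c,c;Δ) y^{Δ+n} ≤ (Σ_j Hi_{n,j}) y^{Δ₁+n}`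
  have hlev : ∀ n : ℕ, hrDiagCoeffAB c c Δ 0 n * y ^ (Δ + n) ≤
      diagLevelBoxBound c₁ c₂ Δ₁ Δ₂ n * y ^ (Δ₁ + n) := fun n => by
    have ha := hrDiagCoeffAB_self_nonneg c hΔ n
    have hb := hrDiagCoeffAB_self_le_levelBoxBound hΔ₁ hΔl hΔu hcl hcu n
    have hpow : y ^ (Δ + n) ≤ y ^ (Δ₁ + n) :=
      Real.rpow_le_rpow_of_exponent_ge hy0 hy1.le (by linarith)
    exact mul_le_mul hb hpow (Real.rpow_nonneg hy0.le _) (ha.trans hb)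
  have hhead : hrDiagPartialSumAB c c Δ 0 N y ≤
      ∑ n ∈ range (N + 1), diagLevelBoxBound c₁ c₂ Δ₁ Δ₂ n * y ^ (Δ₁ + n) := by
    unfold hrDiagPartialSumAB
    exact sum_le_sum fun n _ => hlev n
  have htail : hrDiagCoeffAB c c Δ 0 (N + 1) * y ^ (Δ + N + 1) / (1 - q * y) ≤
      diagLevelBoxBound c₁ c₂ Δ₁ Δ₂ (N + 1) * y ^ (Δ₁ + N + 1) / (1 - q * y) := by
    apply div_le_div_of_nonneg_right _ hgeo.le
    have h := hlev (N + 1)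
    push_cast at h
    rw [show Δ + N + 1 = Δ + ((N : ℝ) + 1) by ring, show Δ₁ + N + 1 = Δ₁ + ((N : ℝ) + 1) by ring]
    exact h
  unfold diagBoxBound
  linarith [hmain, hhead, htail]

end Literature.MathematicalPhysics.QuantumFieldTheory.ConformalBootstrap3D

end
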